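import Summits.Langlands.Langlands.Theses.RamifiedCoefficientSeed
import Literature.NumberTheory.Automorphic.ACCAutomorphyLiftingCrystalline
import Literature.NumberTheory.GaloisRepresentations.AbsIrreducibleIndexTwo
import Literature.NumberTheory.Automorphic.BCDTModularity
import Literature.NumberTheory.GaloisRepresentations.OrdinaryRegular

set_option linter.dupNamespace false

/-!
# Sketch — crux-ideate stmt-Langlands-16781 (`RamifiedCoefficientSeed.SectorComplement`), round 1, ideator 2

First lemmas of the two idea cards, typed over existing declarations (no proofs claimed; every
`def … : Prop` below is a STATEMENT).  Nothing here asserts the crux, the target or the summit.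

* Card A `gso4-tensor-seed`      — §A: `TensorParity`, `TensorSeedLiftingGL4` (+ the region it adds).
* Card B `purity-pins-monodromy-gl3` — §B: `ArchDichotomyGL3`, `DegenerateAvatarGL3` (= DS₃, an open
  leaf of the complement), `RegularityTransferGL3`, `SectorVerbatim` and the bookkeeping
  `sectorComplement_iff_of_verbatim`.
-/

namespace Summit.Langlands.Langlands.Cruxes.SectorComplement.Ideas16781k2

open Summit.Langlands.Langlands.Theses.RamifiedCoefficientSeed
open Literature.NumberTheory.GaloisRepresentations Literature.NumberTheory.Automorphic
open Literature.NumberTheory.PAdicHodge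
open IsDedekindDomain NumberField Filter

/-! ## §A  Card `gso4-tensor-seed` -/

/-- **Tensor parity** (elementary; first checkable statement of card A).  If `ρ : Γ_ℚ → GL₄(ℚ̄_p)`,
`p` odd, is residually the tensor product of two-dimensional `τ₁, τ₂` (trace congruence) and some
complex conjugation has trace `0` on `ρ` (Hodge numbers `(1,1,1,1)`: `tr ρ(c) = 0`), then `τ₁` or `τ₂`
is odd at that conjugation: `tr τ₁(c) · tr τ₂(c) ≡ 0 (mod 𝔪)` with both traces in `{0, ±2}` and `p ∤ 4`.
[folklore] -/
def TensorParity : Prop :=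
  ∀ (p : ℕ) [Fact p.Prime], 3 ≤ p →
  ∀ (ρ : FramedGaloisRep ℚ (PadicAlgCl p) 4) (τ₁ τ₂ : FramedGaloisRep ℚ (PadicAlgCl p) 2),
    (∀ σ, ‖(ρ σ).val.trace - (τ₁ σ).val.trace * (τ₂ σ).val.trace‖ < 1) →
    ∀ (φ : ℚ →+* ℝ) (c : Field.absoluteGaloisGroup ℚ), IsComplexConjugation φ c →
      (ρ c).val.trace = 0 →
        Matrix.GeneralLinearGroup.det (τ₁ c) = -1 ∨ Matrix.GeneralLinearGroup.det (τ₂ c) = -1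

/-- **Tensor-seeded automorphy lifting on `GL₄/ℚ`** (card A's engine ∘ seed; rank-4 analogue of the
route's `AdjointLiftingGL3`).  `p ≥ 17` (`p > n² = 16`); `ρ : Γ_ℚ → GL₄(ℚ̄_p)` unramified a.e.,
crystalline at `p` with labelled Hodge–Tate weights `{0,1,2,3}` for Fontaine's pinned datum,
`ρ̄|_{ℚ(ζ_p)}` absolutely irreducible, and `ρ̄ ≡ τ₁ ⊗ τ₂ (mod 𝔪)` for two ODD `τ₁, τ₂ : Γ_ℚ → GL₂(ℚ̄_p)`
⇒ `ρ` is automorphic in the summit's a.e. format.  Proof plan: Khare–Wintenberger for `τ̄₁, τ̄₂`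
(weights `2`, `3` after the Fontaine–Laffaille tensor bookkeeping), Ramakrishnan's `GL₂ × GL₂ → GL₄`
(cuspidal `g₂ ⊠ g₃` of weight `0` type, level prime to `p`) as the residually automorphic `π`, the
tree's NAMED FACT `ACCGHLNSTT2023.automorphyLifting_crystalline_weightZero` at `n = 4`, `F = ℚ`
(enormous image of `SL₂(𝔽_p) ⊗ SL₂(𝔽_p) ⊂ GL₄`, decomposed genericity and a scalar element by finite
group theory + Chebotarev), and the `|det|^{3/2}` untwist to L-algebraic Satake matching. [conjecture] -/
def TensorSeedLiftingGL4 : Prop :=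
  ∀ (p : ℕ) [Fact p.Prime], 17 ≤ p →
  ∀ ρ : FramedGaloisRep ℚ (PadicAlgCl p) 4,
    (∀ᶠ v : HeightOneSpectrum (𝓞 ℚ) in cofinite, ρ.IsUnramifiedAt v) →
    (∀ (v : HeightOneSpectrum (𝓞 ℚ)) (hv : ((p : ℕ) : 𝓞 ℚ) ∈ v.asIdeal),
      let D := fontainePstAdicCompletion v p hv
      D.IsCrystallineFramed (ρ.toLocal v) ∧
        (letI := D.algebra
         ∀ τ : v.adicCompletion ℚ →ₐ[ℚ_[p]] PadicAlgCl p,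
           ρ.labelledHodgeTateWeightsAt v D.algebra D.𝔅 τ.toRingHom = {0, 1, 2, 3})) →
    (ρ.restrictField (CyclotomicField p ℚ)).IsResiduallyAbsIrreducible →
    (∃ τ₁ τ₂ : FramedGaloisRep ℚ (PadicAlgCl p) 2, τ₁.IsOdd ∧ τ₂.IsOdd ∧
      ∀ σ, ‖(ρ σ).val.trace - (τ₁ σ).val.trace * (τ₂ σ).val.trace‖ < 1) →
    ∀ (ι : PadicAlgCl p ≃+* ℂ) (hcpt : isCompact_glFiniteIntegralLevel 4 ℚ),
      ∃ π : CuspidalAutomorphicRepData 4 ℚ hcpt, π.1.IsLAlgebraic ∧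
        ∀ᶠ v : HeightOneSpectrum (𝓞 ℚ) in cofinite, Summit.Langlands.SatakeFrobCompatibleAt ι π.1 ρ v

/-! ## §B  Card `purity-pins-monodromy-gl3` -/

/-- The degenerate ("`GL₃`-Maass") archimedean type `(t, t, t)`: all three `z`-exponents equal to the
integer `t` at the (unique) complex embedding of `ℚ`. [folklore] -/
def IsDegenerateType (T : InfinityType ℚ 3) (t : ℤ) : Prop :=
  ∀ σ : ℚ →+* ℂ, (T σ).map ArchWeight.a = Multiset.replicate 3 (t : ℂ)

/-- **Archimedean dichotomy for `GL₃(ℝ)`** (Vogan 1986 / Tadić: unitary dual of `GL_n(ℝ)`; Shalika: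
cuspidal ⇒ generic).  An L-algebraic CUSPIDAL `π` on `GL₃(𝔸_ℚ)` is either regular algebraic
(`π_∞ ≃ (D_k × χ) ⊗ |det|^t`, `k` odd `≥ 3`, exponents `t ± (k-1)/2, t` pairwise distinct) or of
degenerate type `(t,t,t)` (`π_∞ ≃ (sgn^{e₁} × sgn^{e₂} × sgn^{e₃}) ⊗ |det|^t`): the complementary
series `π(χ, α) × χ'`, `0 < α < 1/2`, has non-integral exponents `t ± α`, and `D_k × χ` with integral
exponents forces `k` odd. [conjecture] -/
def ArchDichotomyGL3 : Prop :=
  ∀ (hcpt : isCompact_glFiniteIntegralLevel 3 ℚ) (π : CuspidalAutomorphicRepData 3 ℚ hcpt),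
    π.1.IsLAlgebraic →
      π.1.IsRegularAlgebraic ∨ ∃ (T : InfinityType ℚ 3) (t : ℤ), π.1.HasInfinityType T ∧ IsDegenerateType T t

/-- **DS₃ — "Deligne–Serre for `GL₃/ℚ`"** (an OPEN leaf of the complement: direction (A) of the summit
for the degenerate-type cuspidal `π` on `GL₃/ℚ`, a.e. form, with the archimedean recipe HT = `-a`):
every cuspidal `π` of degenerate type `(t,t,t)` has, for every `ℓ, ι`, an `ℓ`-adic avatar
Satake-compatible a.e. whose labelled Hodge–Tate weights at `ℓ` are `{-t,-t,-t}` (an Artin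
representation twisted by `ε^{t}`).  No tool in print (NonRegularWeightBarrier). [conjecture] -/
def DegenerateAvatarGL3 : Prop :=
  ∀ (hcpt : isCompact_glFiniteIntegralLevel 3 ℚ) (π : CuspidalAutomorphicRepData 3 ℚ hcpt)
    (T : InfinityType ℚ 3) (t : ℤ), π.1.HasInfinityType T → IsDegenerateType T t →
    ∀ (ℓ : ℕ) [Fact ℓ.Prime] (ι : PadicAlgCl ℓ ≃+* ℂ),
      ∃ r : FramedGaloisRep ℚ (PadicAlgCl ℓ) 3,
        (∀ᶠ v : HeightOneSpectrum (𝓞 ℚ) in cofinite, Summit.Langlands.SatakeFrobCompatibleAt ι π.1 r v) ∧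
        ∀ (v : HeightOneSpectrum (𝓞 ℚ)) (hv : ((ℓ : ℕ) : 𝓞 ℚ) ∈ v.asIdeal),
          let D := fontainePstAdicCompletion v ℓ hv
          letI := D.algebra
          ∀ τ : v.adicCompletion ℚ →ₐ[ℚ_[ℓ]] PadicAlgCl ℓ,
            r.labelledHodgeTateWeightsAt v D.algebra D.𝔅 τ.toRingHom = Multiset.replicate 3 (-t)

/-- **Regularity transfer on `GL₃/ℚ`** (card B's archimedean step = `ArchDichotomyGL3` + DS₃ +
Chebotarev–Brauer–Nesbitt): an L-algebraic cuspidal `π` on `GL₃/ℚ` that is Satake-compatible a.e.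
with a residually absolutely irreducible `ρ` crystalline at `p` with DISTINCT labelled Hodge–Tate
weights `{0,1,2}` is regular algebraic (cohomological).  This is exactly what upgrades the route's
target output (`IsLAlgebraic ∧ Satake a.e.`) to the hypothesis of HLTT/Varma/ACC+ local–global
engines; inside the cone it costs DS₃. [conjecture] -/
def RegularityTransferGL3 : Prop :=
  ∀ (p : ℕ) [Fact p.Prime] (ρ : FramedGaloisRep ℚ (PadicAlgCl p) 3),
    ρ.IsResiduallyAbsIrreducible →
    (∀ (v : HeightOneSpectrum (𝓞 ℚ)) (hv : ((p : ℕ) : 𝓞 ℚ) ∈ v.asIdeal),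
      let D := fontainePstAdicCompletion v p hv
      D.IsCrystallineFramed (ρ.toLocal v) ∧
        (letI := D.algebra
         ∀ τ : v.adicCompletion ℚ →ₐ[ℚ_[p]] PadicAlgCl p,
           ρ.labelledHodgeTateWeightsAt v D.algebra D.𝔅 τ.toRingHom = {0, 1, 2})) →
    ∀ (ι : PadicAlgCl p ≃+* ℂ) (hcpt : isCompact_glFiniteIntegralLevel 3 ℚ)
      (π : CuspidalAutomorphicRepData 3 ℚ hcpt), π.1.IsLAlgebraic →
      (∀ᶠ v : HeightOneSpectrum (𝓞 ℚ) in cofinite, Summit.Langlands.SatakeFrobCompatibleAt ι π.1 ρ v) →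
        π.1.IsRegularAlgebraic

/-- **The sector VERBATIM** (`X⁺`): what the summit itself re-demands of the route's family inside
`SectorComplement` — for the members: (A) and (B) of `GlobalLanglandsCorrespondenceGLn` ON THE NOSE,
i.e. for EVERY reciprocity datum `𝓡`, an L-algebraic cuspidal `π` with `Corresponds 𝓡 ι π ρ`
(Satake a.e. AND `LocalGlobalCompatibleAt` at every finite place), `ρ` irreducible and
`𝓡`-geometric, unique up to conjugacy among correspondents.  Stated for the family shape of
`ExplicitRamifiedFamily` (members crystalline `{0,1,2}`, residually absolutely irreducible over
`ℚ(ζ_p)`). [conjecture] -/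
def SectorVerbatim : Prop :=
  ∀ (p : ℕ) [Fact p.Prime], 11 ≤ p →
  ∀ ρ : FramedGaloisRep ℚ (PadicAlgCl p) 3,
    (∀ᶠ v : HeightOneSpectrum (𝓞 ℚ) in cofinite, ρ.IsUnramifiedAt v) →
    (∀ (v : HeightOneSpectrum (𝓞 ℚ)) (hv : ((p : ℕ) : 𝓞 ℚ) ∈ v.asIdeal),
      let D := fontainePstAdicCompletion v p hv
      D.IsCrystallineFramed (ρ.toLocal v) ∧
        (letI := D.algebra
         ∀ τ : v.adicCompletion ℚ →ₐ[ℚ_[p]] PadicAlgCl p,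
           ρ.labelledHodgeTateWeightsAt v D.algebra D.𝔅 τ.toRingHom = {0, 1, 2})) →
    (ρ.restrictField (CyclotomicField p ℚ)).IsResiduallyAbsIrreducible →
    (∀ (ι : PadicAlgCl p ≃+* ℂ) (hcpt : isCompact_glFiniteIntegralLevel 3 ℚ),
      ∃ π : CuspidalAutomorphicRepData 3 ℚ hcpt, π.1.IsLAlgebraic ∧
        ∀ᶠ v : HeightOneSpectrum (𝓞 ℚ) in cofinite, Summit.Langlands.SatakeFrobCompatibleAt ι π.1 ρ v) →
    ∀ (𝓡 : Summit.Langlands.ReciprocityData ℚ) (ι : PadicAlgCl p ≃+* ℂ)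
      (hcpt : isCompact_glFiniteIntegralLevel 3 ℚ),
      ρ.toGaloisRep.IsIrreducible ∧ Summit.Langlands.IsGeometricFramed 𝓡 ρ ∧
      ∃ π : CuspidalAutomorphicRepData 3 ℚ hcpt, π.1.IsLAlgebraic ∧
        Summit.Langlands.Corresponds 𝓡 ι π.1 ρ ∧
        ∀ ρ' : FramedGaloisRep ℚ (PadicAlgCl p) 3,
          Summit.Langlands.Corresponds 𝓡 ι π.1 ρ' → Summit.Langlands.IsConjugate ρ ρ'

/-- Bookkeeping (kernel-checked): the sector-verbatim statement is a CONSEQUENCE of the summit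
(direction (B) at `n = 3`, then (A) for the `π` obtained; crystalline ⇒ de Rham for the pinned
datum; residual absolute irreducibility over `ℚ(ζ_p)` ⇒ irreducibility).  So `SectorVerbatim` is a
weakest-unknown-consequence-type statement, never stronger than `Langlands`. [folklore] -/
theorem sectorVerbatim_of_langlands (hL : _root_.Langlands) : SectorVerbatim := by
  intro p _ _hp ρ hunr hcrys hirr _hX 𝓡 ι hcpt
  obtain ⟨-, h⟩ := hL ℚ
  have hAB := h 𝓡 3 (by norm_num) hcpt
  have habs : FramedRep.IsAbsolutelyIrreducible ρ :=
    FramedGaloisRep.IsAbsolutelyIrreducible.of_restrictField (CyclotomicField p ℚ) ρ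
      (FramedGaloisRep.IsResiduallyAbsIrreducible.isAbsolutelyIrreducible three_pos hirr)
  have hρirr : ρ.toGaloisRep.IsIrreducible :=
    (FramedRep.isIrreducible_toContinuousRep_iff ρ).2 habs.isIrreducible
  have hgeo : Summit.Langlands.IsGeometricFramed 𝓡 ρ :=
    ⟨hunr, fun v hv ↦ (hcrys v hv).1.isDeRhamFramed⟩
  obtain ⟨π, hLalg, hcorr⟩ := hAB.2 p ι ρ hρirr hgeo
  refine ⟨hρirr, hgeo, π, hLalg, hcorr, ?_⟩
  obtain ⟨ρ₁, _h1irr, _h1geo, h1corr, h1uniq⟩ := hAB.1 π hLalg p ι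
  intro ρ' hρ'
  obtain ⟨g, hg⟩ := h1uniq ρ hcorr
  obtain ⟨g', hg'⟩ := h1uniq ρ' hρ'
  refine ⟨g' * g⁻¹, ?_⟩
  rw [← hg, ← hg', FramedRep.conj_conj, inv_mul_cancel_right]

/-- Bookkeeping (kernel-checked): under the sector-verbatim statement the frame is unchanged in
strength — `SectorComplement` still IS the summit modulo the target (no `_false_without_` short of
`¬ Langlands`): `X → (SectorComplement ↔ Langlands)`; recorded so that card B's transfer
`C ⟸ (X⁺ → Langlands)` is read correctly (it re-cuts, it does not weaken the junction). [folklore] -/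
theorem sectorComplement_iff_of_target (hX : NonPolarisableFamilyAutomorphic) :
    SectorComplement ↔ _root_.Langlands :=
  ⟨fun hC ↦ hC hX, fun h _ ↦ h⟩

end Summit.Langlands.Langlands.Cruxes.SectorComplement.Ideas16781k2
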